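import Summits.HodgeConjecture.HodgeConjecture.Theses.NikulinTwinTransport

/-!
# Route NikulinTwinTransport · item `TwinSimilitudeAlgebraic` (stmt-HodgeConjecture-13674) — helpers

The target `TwinSimilitudeAlgebraic` (X = Sim₂(K3): every rational, type-preserving `ℂ`-linear
2-similitude `ψ : H²(S′(ℂ); ℂ) → H²(S(ℂ); ℂ)` between projective K3 surfaces is induced by an
algebraic class of codimension `2` on `S ⊗ S′`) is an open sub-case of the Hodge conjecture
(Varesco 2023, Thm. 2.1 covers only the Nikulin locus). This file records what is provable now
and serves the item:

* `induced_zero`, `induced_add`, `induced_smul`, `induced_neg`, `induced_sub`, `induced_sum`: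
  the conclusion predicate of the item — "`ψ` is induced by an algebraic class `γ` on `S ⊗ S′`,
  `ψ x = fst_* (snd^* x ∪ γ)`" — cuts out a `ℂ`-linear subspace of `Hom_ℂ(Hᵃ(S′(ℂ)), Hᵃ⁺²ᵏ⁻²ᵐ⁺²ⁿ(S(ℂ)))`,
  because `algebraicClasses (S ⊗ S′) k` is a `ℂ`-submodule and the cup product and the Gysin
  morphism are `ℂ`-linear (Fulton, *Intersection Theory*, §16.1: correspondences form a group
  under addition and `(α + β)_* = α_* + β_*`). Stated for arbitrary degrees and dimensions so that
  the literal conclusion of the route items (`a = 2·1`, `k = 2`, `n = 2`, `m = 2 + 2`) is an instance.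
* `twinSimilitudeAlgebraic_of_hodgeSimilitudeAlgebraic`: the route's crux
  `HodgeSimilitudeAlgebraic` (all multipliers `r > 0`) specialises at `r = 2` to the target.
-/

noncomputable section

open CategoryTheory MonoidalCategory
open Literature.AlgebraicGeometry.Motives Literature.AlgebraicGeometry.HodgeTheory
open Literature.AlgebraicTopology.SingularHomology

namespace Summit.HodgeConjecture.HodgeConjecture.Theorems.NikulinTwinTransport

section Induced

variable {μ : OrientationFamily} {S S' : SchemeOver ℂ} {m n : ℕ}
  (hT : IsSmoothProjective m (S ⊗ S')) (hS : IsSmoothProjective n S)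
  {a k c b : ℕ} (hac : a + 2 * k = c) (hcb : c + 2 * n = b + 2 * m)

/-- The zero map is induced by the (algebraic) zero class: `0 = fst_* (snd^* x ∪ 0)`.
[folklore] -/
theorem induced_zero :
    ∃ γ ∈ algebraicClasses (S ⊗ S') k, ∀ x : complexBetti S' a,
      (0 : complexBetti S' a →ₗ[ℂ] complexBetti S b) x =
        complexGysin μ hT hS (SemiCartesianMonoidalCategory.fst S S') hcb
          (cupProduct hac (complexBetti.map (SemiCartesianMonoidalCategory.snd S S') a x) γ) :=
  ⟨0, Submodule.zero_mem _, fun x ↦ by simp only [LinearMap.zero_apply, map_zero]⟩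

/-- Sums of maps induced by algebraic classes are induced by the sum of the classes
(`(γ₁ + γ₂)_* = γ₁_* + γ₂_*`: the cup product and the Gysin morphism are additive).
[cite: Fulton1998, §16.1] -/
theorem induced_add {ψ₁ ψ₂ : complexBetti S' a →ₗ[ℂ] complexBetti S b}
    (h₁ : ∃ γ ∈ algebraicClasses (S ⊗ S') k, ∀ x : complexBetti S' a,
      ψ₁ x = complexGysin μ hT hS (SemiCartesianMonoidalCategory.fst S S') hcb
        (cupProduct hac (complexBetti.map (SemiCartesianMonoidalCategory.snd S S') a x) γ))
    (h₂ : ∃ γ ∈ algebraicClasses (S ⊗ S') k, ∀ x : complexBetti S' a,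
      ψ₂ x = complexGysin μ hT hS (SemiCartesianMonoidalCategory.fst S S') hcb
        (cupProduct hac (complexBetti.map (SemiCartesianMonoidalCategory.snd S S') a x) γ)) :
    ∃ γ ∈ algebraicClasses (S ⊗ S') k, ∀ x : complexBetti S' a,
      (ψ₁ + ψ₂) x = complexGysin μ hT hS (SemiCartesianMonoidalCategory.fst S S') hcb
        (cupProduct hac (complexBetti.map (SemiCartesianMonoidalCategory.snd S S') a x) γ) := by
  obtain ⟨γ₁, hγ₁, h₁⟩ := h₁
  obtain ⟨γ₂, hγ₂, h₂⟩ := h₂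
  refine ⟨γ₁ + γ₂, Submodule.add_mem _ hγ₁ hγ₂, fun x ↦ ?_⟩
  rw [LinearMap.add_apply, h₁ x, h₂ x, map_add, map_add]

/-- Scalar multiples of a map induced by an algebraic class are induced by the scalar multiple of
the class (`(c • γ)_* = c • γ_*`; `algebraicClasses` is a `ℂ`-subspace). [cite: Fulton1998, §16.1] -/
theorem induced_smul (r : ℂ) {ψ : complexBetti S' a →ₗ[ℂ] complexBetti S b}
    (h : ∃ γ ∈ algebraicClasses (S ⊗ S') k, ∀ x : complexBetti S' a,
      ψ x = complexGysin μ hT hS (SemiCartesianMonoidalCategory.fst S S') hcb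
        (cupProduct hac (complexBetti.map (SemiCartesianMonoidalCategory.snd S S') a x) γ)) :
    ∃ γ ∈ algebraicClasses (S ⊗ S') k, ∀ x : complexBetti S' a,
      (r • ψ) x = complexGysin μ hT hS (SemiCartesianMonoidalCategory.fst S S') hcb
        (cupProduct hac (complexBetti.map (SemiCartesianMonoidalCategory.snd S S') a x) γ) := by
  obtain ⟨γ, hγ, h⟩ := h
  refine ⟨r • γ, Submodule.smul_mem _ r hγ, fun x ↦ ?_⟩
  rw [LinearMap.smul_apply, h x, map_smul, map_smul]

/-- Negatives of maps induced by algebraic classes are induced by algebraic classes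
(`(-γ)_* = -γ_*`). [cite: Fulton1998, §16.1] -/
theorem induced_neg {ψ : complexBetti S' a →ₗ[ℂ] complexBetti S b}
    (h : ∃ γ ∈ algebraicClasses (S ⊗ S') k, ∀ x : complexBetti S' a,
      ψ x = complexGysin μ hT hS (SemiCartesianMonoidalCategory.fst S S') hcb
        (cupProduct hac (complexBetti.map (SemiCartesianMonoidalCategory.snd S S') a x) γ)) :
    ∃ γ ∈ algebraicClasses (S ⊗ S') k, ∀ x : complexBetti S' a,
      (-ψ) x = complexGysin μ hT hS (SemiCartesianMonoidalCategory.fst S S') hcb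
        (cupProduct hac (complexBetti.map (SemiCartesianMonoidalCategory.snd S S') a x) γ) := by
  obtain ⟨γ, hγ, h⟩ := h
  refine ⟨-γ, Submodule.neg_mem _ hγ, fun x ↦ ?_⟩
  rw [LinearMap.neg_apply, h x, map_neg, map_neg]

/-- Differences of maps induced by algebraic classes are induced by algebraic classes
(`(γ₁ - γ₂)_* = γ₁_* - γ₂_*`). [cite: Fulton1998, §16.1] -/
theorem induced_sub {ψ₁ ψ₂ : complexBetti S' a →ₗ[ℂ] complexBetti S b}
    (h₁ : ∃ γ ∈ algebraicClasses (S ⊗ S') k, ∀ x : complexBetti S' a,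
      ψ₁ x = complexGysin μ hT hS (SemiCartesianMonoidalCategory.fst S S') hcb
        (cupProduct hac (complexBetti.map (SemiCartesianMonoidalCategory.snd S S') a x) γ))
    (h₂ : ∃ γ ∈ algebraicClasses (S ⊗ S') k, ∀ x : complexBetti S' a,
      ψ₂ x = complexGysin μ hT hS (SemiCartesianMonoidalCategory.fst S S') hcb
        (cupProduct hac (complexBetti.map (SemiCartesianMonoidalCategory.snd S S') a x) γ)) :
    ∃ γ ∈ algebraicClasses (S ⊗ S') k, ∀ x : complexBetti S' a,
      (ψ₁ - ψ₂) x = complexGysin μ hT hS (SemiCartesianMonoidalCategory.fst S S') hcb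
        (cupProduct hac (complexBetti.map (SemiCartesianMonoidalCategory.snd S S') a x) γ) := by
  obtain ⟨γ₁, hγ₁, h₁⟩ := h₁
  obtain ⟨γ₂, hγ₂, h₂⟩ := h₂
  refine ⟨γ₁ - γ₂, Submodule.sub_mem _ hγ₁ hγ₂, fun x ↦ ?_⟩
  rw [LinearMap.sub_apply, h₁ x, h₂ x, map_sub, map_sub]

/-- Finite sums of maps induced by algebraic classes are induced by algebraic classes
(`(∑ γᵢ)_* = ∑ (γᵢ)_*`). [cite: Fulton1998, §16.1] -/
theorem induced_sum {ι : Type*} (s : Finset ι) (ψ : ι → (complexBetti S' a →ₗ[ℂ] complexBetti S b))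
    (h : ∀ i ∈ s, ∃ γ ∈ algebraicClasses (S ⊗ S') k, ∀ x : complexBetti S' a,
      ψ i x = complexGysin μ hT hS (SemiCartesianMonoidalCategory.fst S S') hcb
        (cupProduct hac (complexBetti.map (SemiCartesianMonoidalCategory.snd S S') a x) γ)) :
    ∃ γ ∈ algebraicClasses (S ⊗ S') k, ∀ x : complexBetti S' a,
      (∑ i ∈ s, ψ i) x = complexGysin μ hT hS (SemiCartesianMonoidalCategory.fst S S') hcb
        (cupProduct hac (complexBetti.map (SemiCartesianMonoidalCategory.snd S S') a x) γ) := by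
  classical
  induction s using Finset.induction_on with
  | empty =>
    rw [Finset.sum_empty]
    exact induced_zero hT hS hac hcb
  | insert i s hi ih =>
    rw [Finset.sum_insert hi]
    exact induced_add hT hS hac hcb (h i (Finset.mem_insert_self i s))
      (ih fun j hj ↦ h j (Finset.mem_insert_of_mem hj))

end Induced

/-- The route's crux `HodgeSimilitudeAlgebraic` (every rational Hodge similitude of any rational
multiplier `r > 0` between `H²` of projective K3 surfaces is algebraic) gives the target
`TwinSimilitudeAlgebraic` at `r = 2`. [folklore] -/
theorem twinSimilitudeAlgebraic_of_hodgeSimilitudeAlgebraic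
    (h : Theses.NikulinTwinTransport.HodgeSimilitudeAlgebraic) :
    Theses.NikulinTwinTransport.TwinSimilitudeAlgebraic := by
  intro μ hμ S S' hS hS' p p' hp hp' ψ hrat htype hsim
  refine h 2 two_pos μ hμ S S' hS hS' p p' hp hp' ψ hrat htype fun x y a hxy ↦ ?_
  rw [hsim x y a hxy, Rat.cast_ofNat]

end Summit.HodgeConjecture.HodgeConjecture.Theorems.NikulinTwinTransport

end
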